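import Mathlib
import HarnessLib
import Literature.Analysis.FluidPDE.CurlIsometryCovariance
import Summits.NavierStokesRegularity.NavierStokesRegularity.Theses.FilamentPinchDoor
import Summits.NavierStokesRegularity.NavierStokesRegularity.Theorems.PoloidalWindowDoorPoloidalWindowRigidityRotate
import Summits.NavierStokesRegularity.NavierStokesRegularity.Theorems.HalfSpaceWindowDoorCirculationCarryingRigidityDefs
import Summits.NavierStokesRegularity.NavierStokesRegularity.Theorems.HalfSpaceWindowDoorCirculationCarryingRigidityRotate

/-!
# Cross-route edge: `HalfSpaceWindowDoor`'s research stub `HemisphereLiouvilleE3` (crux 25311) IMPLIES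
# `FilamentPinchDoor.FilamentPinchLiouville` (crux stmt-NavierStokesRegularity-26430)

Width seat ns-in-wu-con g2 of 26430 (DIRECTOR-NS dss_71 (b); census `pub/ns-inputs/kits/26430-pinchExclusion-census.md`,
brick I-0; no objection from the LEAD of 25311, ns-hsw-p1 g2, 10:10:58Z).  Both cruxes are one-signed Type-I Liouville
statements; the FilamentPinchDoor class is a SUBCLASS of the HalfSpaceWindowDoor class (it adds suitability on the
backward slab, `𝐈 < ∞`, linear ball growth of the signed vorticity mass and the backward singularity of the origin), the
direction is an arbitrary `e ≠ 0` instead of `e₃`, and the conclusion `⟪curl v, e⟫ ≡ 0` is the same.  Hence the `e₃`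
Liouville statement for the LARGER class gives the crux for the smaller one, by rotation covariance exactly as in
hsw-p1's plumbing stub `…HalfSpaceWindowDoorCirculationCarryingRigidityRotate.stub_rotate` (p611557): conjugate by a
determinant-one linear isometry `L` with `L⁻¹e₃ = e/‖e‖`
(`exists_linearIsometryEquiv_det_one_symm_single_two`); the time-rate class is transported
(`…PoloidalWindowRigidityRotate.class_conj_linearIsometryEquiv`), the sign by the pseudovector law of the curl
(`inner_curl_conj_linearIsometryEquiv`: `⟪curl v'(s)(y), e₃⟫ = ‖e‖⁻¹⟪curl v(s)(L⁻¹y), e⟫`), and the Liouville conclusion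
for `v'` at `L y` is the crux's conclusion for `v` at `y`.  The extra FilamentPinchDoor hypotheses are not consumed.

* `filamentPinchLiouville_of_hemisphereLiouvilleE3 : HemisphereLiouvilleE3 → Theses.FilamentPinchDoor.FilamentPinchLiouville`
  — kernel-visible edge «26430 ⇐ 25311»: if the extremal line of 25311 (`hemisphereLiouvilleE3_iff_no_extremal`,
  `…ExtremalReduction`) closes, crux 26430 closes by `exact`.

Conditional by design (an implication between two OPEN research statements); `--supports` 26430 as a helper.
HONEST FRAMING: door-route statements about HYPOTHETICAL Type-I blow-up profiles; nothing here bears on Navier–Stokes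
regularity; neither crux is proved here; no summit statement is touched.
-/

noncomputable section

-- the summit and its single sub-problem share the name (CONVENTIONS §1), as in every Theorems file
set_option linter.dupNamespace false

namespace Summit.NavierStokesRegularity.NavierStokesRegularity.Theorems.FilamentPinchDoorFilamentPinchLiouvilleOfHemisphereLiouville

open Set Function
open scoped RealInnerProductSpace InnerProductSpace
open Literature.Analysis Literature.Analysis.FluidPDE
open Summit.NavierStokesRegularity.NavierStokesRegularity.Theorems.HalfSpaceWindowDoorCirculationCarryingRigidityDefs
open Summit.NavierStokesRegularity.NavierStokesRegularity.Theorems.PoloidalWindowDoorPoloidalWindowRigidityRotate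
  (class_conj_linearIsometryEquiv)
open Summit.NavierStokesRegularity.NavierStokesRegularity.Theorems.HalfSpaceWindowDoorCirculationCarryingRigidityRotate
  (exists_linearIsometryEquiv_det_one_symm_single_two)

/-- **Cross-route edge `26430 ⇐ 25311`.**  The `e₃`-Liouville statement for closed-hemisphere Type-I ancient Oseen-mild
profiles (`HemisphereLiouvilleE3`, research stub of crux `CirculationCarryingRigidity`, stmt-25311) implies the crux
`FilamentPinchLiouville` of route `FilamentPinchDoor` (stmt-26430): class inclusion + rotation covariance; the
energy-class, ball-growth and backward-singularity hypotheses of 26430 are not used. [folklore] -/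
theorem filamentPinchLiouville_of_hemisphereLiouvilleE3 (hE3 : HemisphereLiouvilleE3) :
    Summit.NavierStokesRegularity.NavierStokesRegularity.Theses.FilamentPinchDoor.FilamentPinchLiouville := by
  intro C v π H hdecay hcont hmild hdiv _hsuit _hH _hI e he hnn _hK _hsing s hs y
  obtain ⟨L, hL, hdet⟩ := exists_linearIsometryEquiv_det_one_symm_single_two he
  obtain ⟨hrate', hcont', hmild', hdiv'⟩ := class_conj_linearIsometryEquiv L hdecay hcont hmild hdiv
  -- the pseudovector law with `det L = 1`: `⟪curl v'(s)(y), e₃⟫ = ‖e‖⁻¹ ⟪curl v(s)(L⁻¹ y), e⟫`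
  have hkey : ∀ s y, ⟪curl (fun z => L (v s (L.symm z))) y, EuclideanSpace.single 2 1⟫_ℝ =
      ‖e‖⁻¹ * ⟪curl (v s) (L.symm y), e⟫_ℝ := by
    intro s y
    have h := inner_curl_conj_linearIsometryEquiv L (v s) y (L.symm (EuclideanSpace.single 2 1))
    rw [LinearIsometryEquiv.apply_symm_apply, hdet, one_mul, hL, inner_smul_right] at h
    exact h
  have hnn' : ∀ s < 0, ∀ y, 0 ≤ ⟪curl ((fun t x => L (v t (L.symm x))) s) y, e3⟫_ℝ := by
    intro s hs y
    show 0 ≤ ⟪curl (fun z => L (v s (L.symm z))) y, EuclideanSpace.single 2 1⟫_ℝ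
    rw [hkey]
    exact mul_nonneg (inv_nonneg.2 (norm_nonneg e)) (hnn s hs (L.symm y))
  have hzero := hE3 C (fun t x => L (v t (L.symm x))) hrate' hcont' hmild' hdiv' hnn'
  have h0 : ⟪curl (fun z => L (v s (L.symm z))) (L y), EuclideanSpace.single 2 1⟫_ℝ = 0 := hzero s hs (L y)
  rw [hkey, LinearIsometryEquiv.symm_apply_apply] at h0
  rcases mul_eq_zero.1 h0 with h1 | h1
  · exact absurd h1 (inv_ne_zero (norm_ne_zero_iff.2 he))
  · exact h1

end Summit.NavierStokesRegularity.NavierStokesRegularity.Theorems.FilamentPinchDoorFilamentPinchLiouvilleOfHemisphereLiouville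

end
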